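import Literature.NumberTheory.EllipticCurves.ThreeTorsionFakePointAssemblyProofs
import HarnessLib

/-!
# The fake-point form of the Galois side of Ogg's formula at `2`: assembly, unit cube root

`Proofs` file (theorems only, no definitions, no named facts) in topic
`NumberTheory/EllipticCurves`, landed by the seat of bsd.S15
(`Literature.NumberTheory.EllipticCurves.conductorNorm_eq_artinConductorNat_of_isElliptic`),
continuing `ThreeTorsionFakePointAssemblyProofs` with the case `3 ∣ v(Δ)` (`e₀ = 1`): then
`δ₁ = ∛Δ / 2^q` is a unit of `S_E` (`E = K(x(E[3]))`), the inertia group of `𝔓 ∩ E` has order `4`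
(`card_inertia_xDivisionField_three_eq_four`), and the valuation certificates are expansions in
`w = δ₁ - d₀` for an odd integer `d₀` with `v(δ₁ - d₀) ≥ 3 v(2)`, which holds after replacing
`δ` by a suitable `ζ^i δ` (`exists_pow_mul_sub_intCast_mem`).

* `exists_radical_generators_ord_sub_intCast` — radicals `ζ, δ, R_k` of `E[3]` in `K̄` together
  with integral generators `ζ, δ, R_k, δ₁ ∈ S_E` (`δ = 2^q δ₁`) such that `v(δ₁ - d₀) ≥ 3 v(2)`,
  for `Δ = 2^{3q} D₁`, `D₁ ≡ d₀³ (mod 8)`, `d₀` odd (rotation of the cube root).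
* `swanConductorAt_torsion_three_of_fakePoint_cert_one` — **the case `e₀ = 1`**:
  `4 · Sw_𝔓(E[3]) = 2 ((2 · 4(γ+1) + (16 + 2v_Δ) - T_Z) + Σ_k (2T_k - T_Z))` from the quadratic
  defect certificates `v(A_k - s_k²) = t_k v(2)` (`t_k` odd, `v(2s_k) = σ_k v(2)`, `t_k ≤ 2σ_k`),
  a unit `δ₁` with `δ = 2^q δ₁`, and the product certificates `v(∏ Z) = T_Z v(2)`,
  `v((Z - Z₂)(Z₃ - Z₄)) = T₀ v(2)`, ….

Ref: Serre, *Local Fields*, Ch. I §7 Prop. 20–22, Ch. IV §1–§2; Silverman *ATAEC* Thm. IV.11.1.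
[cite: SerreLocalFields1979, Ch. IV §1–§2] [cite: SilvermanATAEC1994, Thm. IV.11.1]

## References
* J.-P. Serre, *Local Fields*, GTM 67, Springer 1979, Ch. I §7, Ch. IV §1–§2.
* J. H. Silverman, *Advanced Topics in the Arithmetic of Elliptic Curves*, GTM 151, Springer 1994,
  Ch. IV §10–§11 (Ogg's formula, Thm. 11.1). [cite: SilvermanATAEC1994, Thm. IV.11.1]
-/

noncomputable section

open scoped Classical NumberField Pointwise
open Field IsDedekindDomain Polynomial

attribute [local instance] AddSubgroup.torsionBy.zmodModule
attribute [local instance 1001] IntermediateField.algebra'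
attribute [local instance 1002] AlgebraicClosure.instAlgebra

namespace WeierstrassCurve

open Literature.NumberTheory.EllipticCurves Literature.NumberTheory.GaloisRepresentations

variable {K : Type} [Field K] [NumberField K] (W : WeierstrassCurve K)

set_option maxHeartbeats 1600000 in
set_option synthInstance.maxHeartbeats 400000 in
/-- **Rotated radicals and integral generators.**  For `v ∣ 2` with `3 ∉ v`, `𝔓 ∣ v`,
`Δ = 2^{3q} D₁`, `c₄ = C₄` in `𝓞_K`, an odd integer `d₀` and `D₁ - d₀³ ∈ 8𝓞_K`, there are
radicals `ζ² + ζ + 1 = 0`, `δ³ = Δ`, `R_k² = c₄ - 12ζ^kδ`, `R₀R₁R₂ = c₆` in `K̄` and elements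
`ζ, δ, R₀, R₁, R₂, δ₁ ∈ S_E` (`E = K(x(E[3]))`) with these values, `δ₁ = δ / 2^q`, and
`v_{𝔓_E}(δ₁ - d₀) ≥ 3 v_{𝔓_E}(2)` (replace `δ` by `ζ^iδ`, `exists_pow_mul_sub_intCast_mem`).
[folklore] -/
theorem exists_radical_generators_ord_sub_intCast [W.IsElliptic]
    {v : HeightOneSpectrum (𝓞 K)} (hv2 : (2 : 𝓞 K) ∈ v.asIdeal) (h3 : ((3 : ℕ) : 𝓞 K) ∉ v.asIdeal)
    {𝔓 : Ideal (absIntegers (𝓞 K) K)} (h𝔓 : 𝔓 ∈ v.primesAbove)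
    {D C₄ D₁ : 𝓞 K} (hD : algebraMap (𝓞 K) K D = W.Δ) (hC₄ : algebraMap (𝓞 K) K C₄ = W.c₄)
    {q : ℕ} (hD₁ : (2 : 𝓞 K) ^ (3 * q) * D₁ = D) {d₀ : ℤ} (hd₀ : Odd d₀) {m : 𝓞 K}
    (hm : D₁ - (d₀ : 𝓞 K) ^ 3 = 8 * m) :
    haveI : IsDedekindDomain (integralClosure (𝓞 K) (W.xDivisionField 3)) :=
      integralClosure.isDedekindDomain (𝓞 K) K (W.xDivisionField 3)
    ∃ ζ δ R₀ R₁ R₂ : AlgebraicClosure K, ζ ^ 2 + ζ + 1 = 0 ∧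
      δ ^ 3 = algebraMap K (AlgebraicClosure K) W.Δ ∧
      R₀ ^ 2 = algebraMap K (AlgebraicClosure K) W.c₄ - 12 * δ ∧
      R₁ ^ 2 = algebraMap K (AlgebraicClosure K) W.c₄ - 12 * ζ * δ ∧
      R₂ ^ 2 = algebraMap K (AlgebraicClosure K) W.c₄ - 12 * ζ ^ 2 * δ ∧
      R₀ * R₁ * R₂ = algebraMap K (AlgebraicClosure K) W.c₆ ∧
      ∃ ζE δE R₀E R₁E R₂E δ₁ : integralClosure (𝓞 K) (W.xDivisionField 3),
        ((ζE : W.xDivisionField 3) : AlgebraicClosure K) = ζ ∧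
        ((δE : W.xDivisionField 3) : AlgebraicClosure K) = δ ∧
        ((R₀E : W.xDivisionField 3) : AlgebraicClosure K) = R₀ ∧
        ((R₁E : W.xDivisionField 3) : AlgebraicClosure K) = R₁ ∧
        ((R₂E : W.xDivisionField 3) : AlgebraicClosure K) = R₂ ∧
        ((δ₁ : W.xDivisionField 3) : AlgebraicClosure K) = δ / 2 ^ q ∧
        ((3 : ℕ) : ℕ∞) * ord (𝔓.comap ((W.xDivisionField 3).integralClosureToAbsIntegers (𝓞 K)))
            (2 : integralClosure (𝓞 K) (W.xDivisionField 3)) ≤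
          ord (𝔓.comap ((W.xDivisionField 3).integralClosureToAbsIntegers (𝓞 K))) (δ₁ - d₀) := by
  classical
  haveI : Fact (Nat.Prime 3) := ⟨Nat.prime_three⟩
  have h2K : (2 : K) ≠ 0 := two_ne_zero
  have h3K : (3 : K) ≠ 0 := three_ne_zero
  haveI hDDE : IsDedekindDomain (integralClosure (𝓞 K) (W.xDivisionField 3)) :=
    integralClosure.isDedekindDomain (𝓞 K) K (W.xDivisionField 3)
  haveI : 𝔓.IsPrime := h𝔓.1
  haveI h𝔓max : 𝔓.IsMaximal := HeightOneSpectrum.isMaximal_of_mem_primesAbove h𝔓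
  haveI : IsGalois K (W.xDivisionField 3) := {}
  haveI hPEmax : (𝔓.comap ((W.xDivisionField 3).integralClosureToAbsIntegers (𝓞 K))).IsMaximal :=
    isMaximal_comap_integralClosureToAbsIntegers (𝓞 K) 𝔓 (W.xDivisionField 3)
  have hunderE : (𝔓.comap ((W.xDivisionField 3).integralClosureToAbsIntegers (𝓞 K))).under (𝓞 K) = v.asIdeal := by
    rw [under_comap_integralClosureToAbsIntegers, ← h𝔓.2.over]
  have h2E : (2 : integralClosure (𝓞 K) (W.xDivisionField 3)) ∈
      𝔓.comap ((W.xDivisionField 3).integralClosureToAbsIntegers (𝓞 K)) := by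
    have : (2 : 𝓞 K) ∈ (𝔓.comap ((W.xDivisionField 3).integralClosureToAbsIntegers (𝓞 K))).under (𝓞 K) := by
      rw [hunderE]; exact hv2
    rw [Ideal.under_def, Ideal.mem_comap, map_ofNat] at this
    exact this
  have hPE0 : (𝔓.comap ((W.xDivisionField 3).integralClosureToAbsIntegers (𝓞 K))) ≠ ⊥ := by
    intro h0; rw [h0] at h2E
    exact two_ne_zero ((Ideal.mem_bot).mp h2E)
  have hPE1 : (𝔓.comap ((W.xDivisionField 3).integralClosureToAbsIntegers (𝓞 K))) ≠ ⊤ := hPEmax.ne_top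
  have h3E : (3 : integralClosure (𝓞 K) (W.xDivisionField 3)) ∉
      𝔓.comap ((W.xDivisionField 3).integralClosureToAbsIntegers (𝓞 K)) := by
    intro hmem
    apply h3
    rw [← hunderE, Ideal.under_def, Ideal.mem_comap, map_natCast]
    exact_mod_cast hmem
  have hinjE : ∀ {X Y : integralClosure (𝓞 K) (W.xDivisionField 3)},
      ((X : W.xDivisionField 3) : AlgebraicClosure K) = ((Y : W.xDivisionField 3) : AlgebraicClosure K) →
        X = Y := fun h => Subtype.ext (Subtype.ext h)
  have hval : ∀ r : 𝓞 K, (((algebraMap (𝓞 K) (integralClosure (𝓞 K) (W.xDivisionField 3)) r :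
      integralClosure (𝓞 K) (W.xDivisionField 3)) : W.xDivisionField 3) : AlgebraicClosure K) =
        algebraMap K (AlgebraicClosure K) (algebraMap (𝓞 K) K r) := fun r => rfl
  -- radicals and generators
  obtain ⟨ζ, δ, R₀, R₁, R₂, hζ, hδ, h₀, h₁, h₂, hρ⟩ := W.exists_radical_algebraicClosure
  obtain ⟨ζE, δE, R₀E, R₁E, R₂E, vζ, vδ, vR₀, vR₁, vR₂⟩ :=
    W.exists_integralClosure_xDivisionField_radical hζ hδ h₀ h₁ h₂ hρ hD hC₄
  obtain ⟨mζ, mδ⟩ := W.zeta_mem_and_delta_mem_xDivisionField_three h2K h3K hζ hδ h₀ h₁ h₂ hρ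
  have m2 : (2 : AlgebraicClosure K) ∈ W.xDivisionField 3 := by
    exact_mod_cast (W.xDivisionField 3).natCast_mem 2
  have hD₁K : algebraMap K (AlgebraicClosure K) (algebraMap (𝓞 K) K D) =
      (2 : AlgebraicClosure K) ^ (3 * q) * algebraMap K (AlgebraicClosure K) (algebraMap (𝓞 K) K D₁) := by
    rw [← hD₁, map_mul, map_mul, map_pow, map_pow, map_ofNat, map_ofNat]
  have hδ₁val : (δ / 2 ^ q) ^ 3 = algebraMap K (AlgebraicClosure K) (algebraMap (𝓞 K) K D₁) := by
    have h2 : (2 : AlgebraicClosure K) ≠ 0 := two_ne_zero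
    rw [div_pow, hδ, ← hD, hD₁K, ← pow_mul, mul_comm q 3]
    field_simp
  obtain ⟨δ₁, vδ₁⟩ := W.exists_integralClosure_xDivisionField_of_pow_eq (x := δ / 2 ^ q)
    (div_mem mδ (pow_mem m2 q)) three_pos hδ₁val
  -- ring identities in `S_E`
  have hζ3 : ζ ^ 3 = 1 := by linear_combination (ζ - 1) * hζ
  have eζ : ζE ^ 2 + ζE + 1 = 0 := hinjE (by push_cast; rw [vζ]; exact hζ)
  have eζ3 : ζE ^ 3 = 1 := by linear_combination (ζE - 1) * eζ
  have eδ₁ : δ₁ ^ 3 = algebraMap (𝓞 K) (integralClosure (𝓞 K) (W.xDivisionField 3)) D₁ :=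
    hinjE (by push_cast; rw [vδ₁, hδ₁val]; rfl)
  have hmS : algebraMap (𝓞 K) (integralClosure (𝓞 K) (W.xDivisionField 3)) D₁ -
      (d₀ : integralClosure (𝓞 K) (W.xDivisionField 3)) ^ 3 =
        8 * algebraMap (𝓞 K) (integralClosure (𝓞 K) (W.xDivisionField 3)) m := by
    have h := congrArg (algebraMap (𝓞 K) (integralClosure (𝓞 K) (W.xDivisionField 3))) hm
    rw [map_sub, map_pow, map_intCast, map_mul, map_ofNat] at h
    exact h
  obtain ⟨i, hi3, -, hw⟩ := exists_pow_mul_sub_intCast_mem _ hPE0 hPE1 eζ eδ₁ hd₀ hmS h2E h3E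
  -- the rotation `δ ↦ ζ^i δ`
  have hrot : ∀ j : ℕ, (ζ ^ j * δ) ^ 3 = algebraMap K (AlgebraicClosure K) W.Δ := by
    intro j
    rw [mul_pow, ← pow_mul, mul_comm j 3, pow_mul, hζ3, one_pow, one_mul, hδ]
  have vrot : ∀ j : ℕ, (((ζE ^ j * δ₁ : integralClosure (𝓞 K) (W.xDivisionField 3)) :
      W.xDivisionField 3) : AlgebraicClosure K) = ζ ^ j * δ / 2 ^ q := by
    intro j; push_cast; rw [vζ, vδ₁, mul_div_assoc]
  have vrotδ : ∀ j : ℕ, (((ζE ^ j * δE : integralClosure (𝓞 K) (W.xDivisionField 3)) :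
      W.xDivisionField 3) : AlgebraicClosure K) = ζ ^ j * δ := by
    intro j; push_cast; rw [vζ, vδ]
  interval_cases i
  · refine ⟨ζ, δ, R₀, R₁, R₂, hζ, hδ, h₀, h₁, h₂, hρ, ζE, δE, R₀E, R₁E, R₂E, δ₁, vζ, vδ, vR₀, vR₁, vR₂, vδ₁, ?_⟩
    simpa using hw
  · refine ⟨ζ, ζ ^ 1 * δ, R₁, R₂, R₀, hζ, hrot 1, ?_, ?_, ?_, ?_, ζE, ζE ^ 1 * δE, R₁E, R₂E, R₀E, ζE ^ 1 * δ₁,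
      vζ, vrotδ 1, vR₁, vR₂, vR₀, vrot 1, hw⟩
    · rw [h₁]; ring
    · rw [h₂]; ring
    · linear_combination h₀ + 12 * δ * (ζ - 1) * hζ
    · rw [← hρ]; ring
  · refine ⟨ζ, ζ ^ 2 * δ, R₂, R₀, R₁, hζ, hrot 2, ?_, ?_, ?_, ?_, ζE, ζE ^ 2 * δE, R₂E, R₀E, R₁E, ζE ^ 2 * δ₁,
      vζ, vrotδ 2, vR₂, vR₀, vR₁, vrot 2, hw⟩
    · rw [h₂]; ring
    · linear_combination h₀ + 12 * δ * (ζ - 1) * hζ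
    · linear_combination h₁ + 12 * ζ * δ * (ζ - 1) * hζ
    · rw [← hρ]; ring

set_option maxHeartbeats 1600000 in
set_option synthInstance.maxHeartbeats 400000 in
/-- **The case `e₀ = 1` (`3 ∣ v(Δ)`, unit `δ₁ = ∛Δ/2^q`): `4 · Sw_𝔓(E[3])` from the certificates.**
Setting of `card_mul_swanConductorAt_torsion_three_eq_of_fakePoint_cert`; in addition the three
quadratic defects `A_k - s_k²` (`A_k = (q_k R_k)²`, `s_k` fixed by every `σ` fixing `ζ, δ`) with
certificates `v(A_k - s_k²) = t_k v(2)` (`t_k` odd), `v(2 s_k) = σ_k v(2)`, `t_k ≤ 2σ_k`, and a unit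
`δ₁ ∈ S_E` with `δ₁ = δ / 2^q`.  Then `#Q₁ = 4`
(`card_ramificationSubgroup_one_xDivisionField_three_eq_four_of_sq`), `#Q₀ = 4`
(`card_inertia_xDivisionField_three_eq_four`), and
`4 · Sw_𝔓(E[3]) = 2 ((2 · 4(γ+1) + (16 + 2v_Δ) - T_Z) + Σ_k (2T_k - T_Z))`.
[cite: SilvermanATAEC1994, Thm. IV.11.1] [cite: SerreLocalFields1979, Ch. IV §1–§2] -/
theorem swanConductorAt_torsion_three_of_fakePoint_cert_one [W.IsElliptic]
    {v : HeightOneSpectrum (𝓞 K)} (hv2 : (2 : 𝓞 K) ∈ v.asIdeal) (hπ2 : (2 : 𝓞 K) ∉ v.asIdeal ^ 2)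
    {𝔓 : Ideal (absIntegers (𝓞 K) K)} (h𝔓 : 𝔓 ∈ v.primesAbove)
    {ζ δ R₀ R₁ R₂ : AlgebraicClosure K} (hζ : ζ ^ 2 + ζ + 1 = 0)
    (hδ : δ ^ 3 = algebraMap K (AlgebraicClosure K) W.Δ)
    (h₀ : R₀ ^ 2 = algebraMap K (AlgebraicClosure K) W.c₄ - 12 * δ)
    (h₁ : R₁ ^ 2 = algebraMap K (AlgebraicClosure K) W.c₄ - 12 * ζ * δ)
    (h₂ : R₂ ^ 2 = algebraMap K (AlgebraicClosure K) W.c₄ - 12 * ζ ^ 2 * δ)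
    (hρ : R₀ * R₁ * R₂ = algebraMap K (AlgebraicClosure K) W.c₆) (hc₆ : W.c₆ ≠ 0)
    {D : 𝓞 K} (hD : algebraMap (𝓞 K) K D = W.Δ)
    {Du : integralClosure (𝓞 K) (W.xDivisionField 3)} {vD : ℕ}
    (hDfac : algebraMap (𝓞 K) (integralClosure (𝓞 K) (W.xDivisionField 3)) D = 2 ^ vD * Du)
    (hDu : Du ∉ 𝔓.comap ((W.xDivisionField 3).integralClosureToAbsIntegers (𝓞 K)))
    {δ₁ : integralClosure (𝓞 K) (W.xDivisionField 3)} {q : ℕ}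
    (vδ₁ : ((δ₁ : W.xDivisionField 3) : AlgebraicClosure K) = δ / 2 ^ q)
    (hδ₁u : δ₁ ∉ 𝔓.comap ((W.xDivisionField 3).integralClosureToAbsIntegers (𝓞 K)))
    -- defects
    {q₀ q₁ q₂ : AlgebraicClosure K} (mq₀ : q₀ ∈ W.xDivisionField 3) (mq₁ : q₁ ∈ W.xDivisionField 3)
    (mq₂ : q₂ ∈ W.xDivisionField 3)
    (hq₀ : ∀ σ : absoluteGaloisGroup K, σ • ζ = ζ → σ • δ = δ → σ • q₀ = q₀)
    (hq₁ : ∀ σ : absoluteGaloisGroup K, σ • ζ = ζ → σ • δ = δ → σ • q₁ = q₁)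
    (hq₂ : ∀ σ : absoluteGaloisGroup K, σ • ζ = ζ → σ • δ = δ → σ • q₂ = q₂)
    {A₀ A₁ A₂ s₀ s₁ s₂ : integralClosure (𝓞 K) (W.xDivisionField 3)}
    (hA₀ : ((A₀ : W.xDivisionField 3) : AlgebraicClosure K) = (q₀ * R₀) ^ 2)
    (hA₁ : ((A₁ : W.xDivisionField 3) : AlgebraicClosure K) = (q₁ * R₁) ^ 2)
    (hA₂ : ((A₂ : W.xDivisionField 3) : AlgebraicClosure K) = (q₂ * R₂) ^ 2)
    (hs₀ : ∀ σ : absoluteGaloisGroup K, σ • ζ = ζ → σ • δ = δ →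
      σ • ((s₀ : W.xDivisionField 3) : AlgebraicClosure K) = ((s₀ : W.xDivisionField 3) : AlgebraicClosure K))
    (hs₁ : ∀ σ : absoluteGaloisGroup K, σ • ζ = ζ → σ • δ = δ →
      σ • ((s₁ : W.xDivisionField 3) : AlgebraicClosure K) = ((s₁ : W.xDivisionField 3) : AlgebraicClosure K))
    (hs₂ : ∀ σ : absoluteGaloisGroup K, σ • ζ = ζ → σ • δ = δ →
      σ • ((s₂ : W.xDivisionField 3) : AlgebraicClosure K) = ((s₂ : W.xDivisionField 3) : AlgebraicClosure K))
    {t₀ t₁ t₂ σ₀ σ₁ σ₂ : ℕ} (hto₀ : Odd t₀) (hto₁ : Odd t₁) (hto₂ : Odd t₂)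
    (ht₀ : ord (𝔓.comap ((W.xDivisionField 3).integralClosureToAbsIntegers (𝓞 K))) (A₀ - s₀ ^ 2) =
      t₀ * ord (𝔓.comap ((W.xDivisionField 3).integralClosureToAbsIntegers (𝓞 K)))
        (2 : integralClosure (𝓞 K) (W.xDivisionField 3)))
    (ht₁ : ord (𝔓.comap ((W.xDivisionField 3).integralClosureToAbsIntegers (𝓞 K))) (A₁ - s₁ ^ 2) =
      t₁ * ord (𝔓.comap ((W.xDivisionField 3).integralClosureToAbsIntegers (𝓞 K)))
        (2 : integralClosure (𝓞 K) (W.xDivisionField 3)))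
    (ht₂ : ord (𝔓.comap ((W.xDivisionField 3).integralClosureToAbsIntegers (𝓞 K))) (A₂ - s₂ ^ 2) =
      t₂ * ord (𝔓.comap ((W.xDivisionField 3).integralClosureToAbsIntegers (𝓞 K)))
        (2 : integralClosure (𝓞 K) (W.xDivisionField 3)))
    (hσ₀ : ord (𝔓.comap ((W.xDivisionField 3).integralClosureToAbsIntegers (𝓞 K))) (2 * s₀) =
      σ₀ * ord (𝔓.comap ((W.xDivisionField 3).integralClosureToAbsIntegers (𝓞 K)))
        (2 : integralClosure (𝓞 K) (W.xDivisionField 3)))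
    (hσ₁ : ord (𝔓.comap ((W.xDivisionField 3).integralClosureToAbsIntegers (𝓞 K))) (2 * s₁) =
      σ₁ * ord (𝔓.comap ((W.xDivisionField 3).integralClosureToAbsIntegers (𝓞 K)))
        (2 : integralClosure (𝓞 K) (W.xDivisionField 3)))
    (hσ₂ : ord (𝔓.comap ((W.xDivisionField 3).integralClosureToAbsIntegers (𝓞 K))) (2 * s₂) =
      σ₂ * ord (𝔓.comap ((W.xDivisionField 3).integralClosureToAbsIntegers (𝓞 K)))
        (2 : integralClosure (𝓞 K) (W.xDivisionField 3)))
    (htσ₀ : t₀ ≤ 2 * σ₀) (htσ₁ : t₁ ≤ 2 * σ₁) (htσ₂ : t₂ ≤ 2 * σ₂)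
    -- fake point
    {Z Z₂ Z₃ Z₄ Y₀ Y₂ Y₃ Y₄ sP : integralClosure (𝓞 K) (W.xDivisionField 3)} {P : Polynomial (𝓞 K)} {γ : ℕ}
    (hZ : ((Z : W.xDivisionField 3) : AlgebraicClosure K) =
      (P.map (algebraMap (𝓞 K) (AlgebraicClosure K))).eval (3 * (R₀ + R₁ + R₂)) ^ 2 -
        algebraMap (𝓞 K) (AlgebraicClosure K) (2 ^ γ) ^ 2 * ((3 * (R₀ + R₁ + R₂)) ^ 3
          - 27 * algebraMap K _ W.c₄ * (3 * (R₀ + R₁ + R₂)) - 54 * algebraMap K _ W.c₆))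
    (hZ₂ : ((Z₂ : W.xDivisionField 3) : AlgebraicClosure K) =
      (P.map (algebraMap (𝓞 K) (AlgebraicClosure K))).eval (3 * (R₀ - R₁ - R₂)) ^ 2 -
        algebraMap (𝓞 K) (AlgebraicClosure K) (2 ^ γ) ^ 2 * ((3 * (R₀ - R₁ - R₂)) ^ 3
          - 27 * algebraMap K _ W.c₄ * (3 * (R₀ - R₁ - R₂)) - 54 * algebraMap K _ W.c₆))
    (hZ₃ : ((Z₃ : W.xDivisionField 3) : AlgebraicClosure K) =
      (P.map (algebraMap (𝓞 K) (AlgebraicClosure K))).eval (3 * (-R₀ + R₁ - R₂)) ^ 2 -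
        algebraMap (𝓞 K) (AlgebraicClosure K) (2 ^ γ) ^ 2 * ((3 * (-R₀ + R₁ - R₂)) ^ 3
          - 27 * algebraMap K _ W.c₄ * (3 * (-R₀ + R₁ - R₂)) - 54 * algebraMap K _ W.c₆))
    (hZ₄ : ((Z₄ : W.xDivisionField 3) : AlgebraicClosure K) =
      (P.map (algebraMap (𝓞 K) (AlgebraicClosure K))).eval (3 * (-R₀ - R₁ + R₂)) ^ 2 -
        algebraMap (𝓞 K) (AlgebraicClosure K) (2 ^ γ) ^ 2 * ((3 * (-R₀ - R₁ + R₂)) ^ 3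
          - 27 * algebraMap K _ W.c₄ * (3 * (-R₀ - R₁ + R₂)) - 54 * algebraMap K _ W.c₆))
    (hY₀ : ((Y₀ : W.xDivisionField 3) : AlgebraicClosure K) =
      (3 * (R₀ + R₁ + R₂)) ^ 3 - 27 * algebraMap K _ W.c₄ * (3 * (R₀ + R₁ + R₂)) - 54 * algebraMap K _ W.c₆)
    (hY₂ : ((Y₂ : W.xDivisionField 3) : AlgebraicClosure K) =
      (3 * (R₀ - R₁ - R₂)) ^ 3 - 27 * algebraMap K _ W.c₄ * (3 * (R₀ - R₁ - R₂)) - 54 * algebraMap K _ W.c₆)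
    (hY₃ : ((Y₃ : W.xDivisionField 3) : AlgebraicClosure K) =
      (3 * (-R₀ + R₁ - R₂)) ^ 3 - 27 * algebraMap K _ W.c₄ * (3 * (-R₀ + R₁ - R₂)) - 54 * algebraMap K _ W.c₆)
    (hY₄ : ((Y₄ : W.xDivisionField 3) : AlgebraicClosure K) =
      (3 * (-R₀ - R₁ + R₂)) ^ 3 - 27 * algebraMap K _ W.c₄ * (3 * (-R₀ - R₁ + R₂)) - 54 * algebraMap K _ W.c₆)
    (hsP : ((sP : W.xDivisionField 3) : AlgebraicClosure K) =
      (P.map (algebraMap (𝓞 K) (AlgebraicClosure K))).eval (3 * (R₀ + R₁ + R₂)))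
    {TZ TE₀ TE₁ TE₂ : ℕ} (hTZ : Odd TZ)
    (hZprod : ord (𝔓.comap ((W.xDivisionField 3).integralClosureToAbsIntegers (𝓞 K))) (Z * Z₂ * Z₃ * Z₄) =
      TZ * ord (𝔓.comap ((W.xDivisionField 3).integralClosureToAbsIntegers (𝓞 K)))
        (2 : integralClosure (𝓞 K) (W.xDivisionField 3)))
    (hE₀ : ord (𝔓.comap ((W.xDivisionField 3).integralClosureToAbsIntegers (𝓞 K))) ((Z - Z₂) * (Z₃ - Z₄)) =
      TE₀ * ord (𝔓.comap ((W.xDivisionField 3).integralClosureToAbsIntegers (𝓞 K)))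
        (2 : integralClosure (𝓞 K) (W.xDivisionField 3)))
    (hE₁ : ord (𝔓.comap ((W.xDivisionField 3).integralClosureToAbsIntegers (𝓞 K))) ((Z - Z₃) * (Z₂ - Z₄)) =
      TE₁ * ord (𝔓.comap ((W.xDivisionField 3).integralClosureToAbsIntegers (𝓞 K)))
        (2 : integralClosure (𝓞 K) (W.xDivisionField 3)))
    (hE₂ : ord (𝔓.comap ((W.xDivisionField 3).integralClosureToAbsIntegers (𝓞 K))) ((Z - Z₄) * (Z₂ - Z₃)) =
      TE₂ * ord (𝔓.comap ((W.xDivisionField 3).integralClosureToAbsIntegers (𝓞 K)))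
        (2 : integralClosure (𝓞 K) (W.xDivisionField 3)))
    (hb₀ : 2 * TE₀ - TZ ≤ 2 * ((γ + 1) * (4 * 1)) + (16 * 1 + 2 * 1 * vD) - TZ)
    (hb₁ : 2 * TE₁ - TZ ≤ 2 * ((γ + 1) * (4 * 1)) + (16 * 1 + 2 * 1 * vD) - TZ)
    (hb₂ : 2 * TE₂ - TZ ≤ 2 * ((γ + 1) * (4 * 1)) + (16 * 1 + 2 * 1 * vD) - TZ) :
    ((4 * 1 : ℕ) : ℝ) * (W.torsionGaloisRep 3).swanConductorAt (𝓞 K) 𝔓 =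
      2 * ((2 * ((γ + 1) * (4 * 1)) + (16 * 1 + 2 * 1 * vD) - TZ : ℕ) +
        (((2 * TE₀ - TZ) + (2 * TE₁ - TZ) + (2 * TE₂ - TZ) : ℕ) : ℝ)) := by
  classical
  haveI : Fact (Nat.Prime 3) := ⟨Nat.prime_three⟩
  have h3 : ((3 : ℕ) : 𝓞 K) ∉ v.asIdeal := by
    intro h3v
    have e : (1 : 𝓞 K) = ((3 : ℕ) : 𝓞 K) - 2 := by norm_num
    have h1 : (1 : 𝓞 K) ∈ v.asIdeal := by rw [e]; exact Ideal.sub_mem _ h3v hv2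
    exact v.isPrime.ne_top ((Ideal.eq_top_iff_one _).mpr h1)
  haveI hDDE : IsDedekindDomain (integralClosure (𝓞 K) (W.xDivisionField 3)) :=
    integralClosure.isDedekindDomain (𝓞 K) K (W.xDivisionField 3)
  haveI : 𝔓.IsPrime := h𝔓.1
  haveI h𝔓max : 𝔓.IsMaximal := HeightOneSpectrum.isMaximal_of_mem_primesAbove h𝔓
  haveI : IsGalois K (W.xDivisionField 3) := {}
  haveI hPEmax : (𝔓.comap ((W.xDivisionField 3).integralClosureToAbsIntegers (𝓞 K))).IsMaximal :=
    isMaximal_comap_integralClosureToAbsIntegers (𝓞 K) 𝔓 (W.xDivisionField 3)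
  have hunderE : (𝔓.comap ((W.xDivisionField 3).integralClosureToAbsIntegers (𝓞 K))).under (𝓞 K) = v.asIdeal := by
    rw [under_comap_integralClosureToAbsIntegers, ← h𝔓.2.over]
  have h2E : (2 : integralClosure (𝓞 K) (W.xDivisionField 3)) ∈
      𝔓.comap ((W.xDivisionField 3).integralClosureToAbsIntegers (𝓞 K)) := by
    have : (2 : 𝓞 K) ∈ (𝔓.comap ((W.xDivisionField 3).integralClosureToAbsIntegers (𝓞 K))).under (𝓞 K) := by
      rw [hunderE]; exact hv2
    rw [Ideal.under_def, Ideal.mem_comap, map_ofNat] at this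
    exact this
  have hPE0 : (𝔓.comap ((W.xDivisionField 3).integralClosureToAbsIntegers (𝓞 K))) ≠ ⊥ := by
    intro h0; rw [h0] at h2E
    exact two_ne_zero ((Ideal.mem_bot).mp h2E)
  have h2S : algebraMap (𝓞 K) (integralClosure (𝓞 K) (W.xDivisionField 3)) 2 = 2 := map_ofNat _ 2
  -- the slope bounds `v(A_k - s_k²) ≤ 2 v(2 s_k)`
  have hle : ∀ (X Y : integralClosure (𝓞 K) (W.xDivisionField 3)) (t σ : ℕ),
      ord (𝔓.comap ((W.xDivisionField 3).integralClosureToAbsIntegers (𝓞 K))) X =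
        t * ord (𝔓.comap ((W.xDivisionField 3).integralClosureToAbsIntegers (𝓞 K)))
          (2 : integralClosure (𝓞 K) (W.xDivisionField 3)) →
      ord (𝔓.comap ((W.xDivisionField 3).integralClosureToAbsIntegers (𝓞 K))) Y =
        σ * ord (𝔓.comap ((W.xDivisionField 3).integralClosureToAbsIntegers (𝓞 K)))
          (2 : integralClosure (𝓞 K) (W.xDivisionField 3)) →
      t ≤ 2 * σ →
      ord (𝔓.comap ((W.xDivisionField 3).integralClosureToAbsIntegers (𝓞 K))) X ≤
        2 * ord (𝔓.comap ((W.xDivisionField 3).integralClosureToAbsIntegers (𝓞 K))) Y := by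
    intro X Y t σ hX hY htσ
    rw [hX, hY, ← mul_assoc]
    have h : (t : ℕ∞) ≤ 2 * σ := by exact_mod_cast htσ
    exact mul_le_mul_left h _
  -- `#Q₁ = 4`
  have hcard := W.card_ramificationSubgroup_one_xDivisionField_three_eq_four_of_sq hv2 h3 h𝔓 hζ hδ h₀ h₁ h₂ hρ hc₆
    hv2 hπ2 mq₀ mq₁ mq₂ hq₀ hq₁ hq₂ hA₀ hA₁ hA₂ hs₀ hs₁ hs₂ (e₀ := 1) (by decide) hto₀ hto₁ hto₂
    (by rw [Nat.cast_one, one_mul, h2S]; exact ht₀) (by rw [Nat.cast_one, one_mul, h2S]; exact ht₁)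
    (by rw [Nat.cast_one, one_mul, h2S]; exact ht₂)
    (hle _ _ _ _ ht₀ hσ₀ htσ₀) (hle _ _ _ _ ht₁ hσ₁ htσ₁) (hle _ _ _ _ ht₂ hσ₂ htσ₂)
  -- `#Q₀ = 4`
  have hd : ((2 : 𝓞 K) ^ q) ≠ 0 := pow_ne_zero _ two_ne_zero
  have hδ₁' : ((δ₁ : W.xDivisionField 3) : AlgebraicClosure K) *
      algebraMap K (AlgebraicClosure K) (algebraMap (𝓞 K) K (2 ^ q)) = δ := by
    rw [vδ₁, map_pow, map_pow, map_ofNat, map_ofNat]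
    field_simp
  have hG₀ := W.card_inertia_xDivisionField_three_eq_four h3 h𝔓 hζ hδ h₀ h₁ h₂ hρ hc₆ hcard hd hδ₁' hδ₁u
  exact W.card_mul_swanConductorAt_torsion_three_eq_of_fakePoint_cert hv2 hπ2 h𝔓 hζ hδ h₀ h₁ h₂ hρ hc₆ hD hcard
    (e₀ := 1) (hG₀.trans (by norm_num)) hDfac hDu hZ hZ₂ hZ₃ hZ₄ hY₀ hY₂ hY₃ hY₄ hsP hTZ
    (by rw [Nat.cast_one, one_mul]; exact hZprod) (by rw [Nat.cast_one, one_mul]; exact hE₀)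
    (by rw [Nat.cast_one, one_mul]; exact hE₁) (by rw [Nat.cast_one, one_mul]; exact hE₂) hb₀ hb₁ hb₂

end WeierstrassCurve

end
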